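import Summits.CriticalPhenomena.PercolationContinuityZ3.Theorems.PercNearOneGluingNoHeavyPcintWindowCertZ3K6Defs
import HarnessLib

/-!
# PCINT lane, kernel check 8/8 of the B3 window certificate (`d = 3`, memory 6, `p = 0.2149`): codes `6804 ≤ n < 7776`

Cell `prim-pcint`, seat `prim-pcint-2`. The Collatz–Wielandt rows `10^5 · rowN ≤ 99995 · 10^24 · v` for the windows with
base-6 code in `[6804, 7776)`, by `decide +kernel` (natural-number arithmetic only; two chunks of 486 codes, ≈ 40 s of
kernel time each, hence `maxHeartbeats 0`). Does NOT build on p205010.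
-/

namespace Summit.CriticalPhenomena.PercolationContinuityZ3.Theorems.Pcint.Z3K6

set_option maxHeartbeats 0 in
/-- Rows `6804 ≤ n < 7290` of the certificate hold. [folklore] -/
theorem checkRange_8a : checkRange 6804 7290 = true := by decide +kernel

set_option maxHeartbeats 0 in
/-- Rows `7290 ≤ n < 7776` of the certificate hold. [folklore] -/
theorem checkRange_8b : checkRange 7290 7776 = true := by decide +kernel

/-- Rows `6804 ≤ n < 7776` of the certificate hold. [folklore] -/
theorem checkRange_8 : checkRange 6804 7776 = true := checkRange_of_split checkRange_8a checkRange_8b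

end Summit.CriticalPhenomena.PercolationContinuityZ3.Theorems.Pcint.Z3K6
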